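import Mathlib
import HarnessLib
import Summits.NavierStokesRegularity.NavierStokesRegularity.Theorems.PoloidalWindowDoorPoloidalWindowRigidityZShockSFReduction

/-!
# Crux K2 `PoloidalWindowRigidity` (stmt-NavierStokesRegularity-19708), line `z_shock` — on the Aut column the stub's THICK clause is
# REDUNDANT: «not (TV) on any sub-window» already implies «not (TH) on any sub-window»

`--supports stmt-NavierStokesRegularity-19708 --as helper` (leafhand-ns-poloidalwindowdoor-3 g13, cell decomp-ns, 2026-08-31).  Def-free.
**No stub and no summit is closed by this file; Navier–Stokes regularity is NOT proved here (rung 0).**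

The deciding stub `stub_zShockThickAut` carries, besides its local autonomy clause (`∂_z v_b = g(t,v₂)∂_b v₂` near `z₀`), the pins
`hpin` («on no open sub-window is the slope a function of `t` alone», not (TV)) and `hthick` («on no open sub-window is the slope a
function of `(t, x₂)`», not (TH) = THICK).  Within the stratum (SF) and off `{∇ₕv₂ = 0}` these coincide: if the slope is
`∂_sG(t, v₂)` AND a function of `(t, x₂)` on an open set, then along horizontal lines `∂_sG(t, v₂(t,·))` is constant, so
`∂_s²G(t,v₂)·∂_b v₂ = 0`, i.e. `∂_s²G(t, v₂) = 0` there — contradicting the genuine nonlinearity forced by `hpin`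
(`…ZShockSFReduction.exists_gn_point_of_not_tv`).  Since bridge B1 puts EVERY point of the window on the (SF) stratum
(`…ZShockSlopeFunctionSourceLocal.clebschSource_horizConst_of_class_autonomy`), we get:

* ★ `thick_of_notTV_of_class_autonomy` — class binders + the local autonomy clause on an open nonempty `W₁` of the slab + `∇ₕv₂ ≠ 0` on
  the window `W` + `hpin` on `W` ⟹ `hthick` on `W` (the stub's THICK clause, verbatim shape).

Planner-facing: on the Aut column (skeleton c3e8eee2, v3) `hthick` may be dropped from `stub_zShockThickAut` / from `hSF` of
`…ZShockSFReduction`; conceptually «Aut ∧ ¬(TV) ⇒ THICK».  presearch: n/a (tree-internal). [folklore]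
-/

noncomputable section

-- the summit and its single sub-problem share the name (CONVENTIONS §1), as in every Theorems file
set_option linter.dupNamespace false

namespace Summit.NavierStokesRegularity.NavierStokesRegularity.Theorems.PoloidalWindowDoorPoloidalWindowRigidityZShockThickOfNotTV

open Set Filter Topology Function Metric InnerProductSpace
open scoped RealInnerProductSpace InnerProductSpace ContDiff
open Literature.Analysis Literature.Analysis.FluidPDE
open Summit.NavierStokesRegularity.NavierStokesRegularity.Theorems.LocalSineTubeDoorProfileAlignedWindowRigidityAncient
open Summit.NavierStokesRegularity.NavierStokesRegularity.Theorems.PoloidalWindowDoorPoloidalWindowRigidityVelocityGradientLaw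
open Summit.NavierStokesRegularity.NavierStokesRegularity.Theorems.PoloidalWindowDoorPoloidalWindowRigidityMaterialLeibniz
open Summit.NavierStokesRegularity.NavierStokesRegularity.Theorems.PoloidalWindowDoorPoloidalWindowRigiditySlopeFunctionPressure
open Summit.NavierStokesRegularity.NavierStokesRegularity.Theorems.PoloidalWindowDoorPoloidalWindowRigidityZShockSlopeFunctionSourceLocal
open Summit.NavierStokesRegularity.NavierStokesRegularity.Theorems.PoloidalWindowDoorPoloidalWindowRigidityZShockSFReduction

variable {C : ℝ} {v : ℝ → EuclideanSpace ℝ (Fin 3) → EuclideanSpace ℝ (Fin 3)}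

/-- ★ **Aut ∧ ¬(TV) ⇒ THICK.**  Class binders of `stub_zShockThickAut` (Type-I rate, continuity, Oseen identity, divergence-free,
poloidal), the stub's LOCAL autonomy clause on an open nonempty `W₁` of the backward slab, a window `W` inside the slab on which
`∇ₕv₂ ≠ 0` and on which no open nonempty sub-window carries a time-only slope (`hpin`).  Then no open nonempty sub-window of `W` carries a
slope that is a function of `(t, x₂)` — the stub's `hthick` clause. [folklore] -/
theorem thick_of_notTV_of_class_autonomy (hrate : HasTypeITimeDecay C v)
    (hcont : ContinuousOn (uncurry v) (Iio (0 : ℝ) ×ˢ univ))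
    (hmild : ∀ s t : ℝ, s < t → t < 0 → ∀ x,
      v t x = UnboundedOperators.heatExtension (v s) (t - s) x - oseenDuhamel 1 s v v t x)
    (hdiv : ∀ t < 0, VectorCalculus.IsDivFree (v t))
    (hpol : ∀ s < 0, ∀ y, ⟪curl (v s) y, EuclideanSpace.single 2 1⟫_ℝ = 0)
    {W : Set (ℝ × EuclideanSpace ℝ (Fin 3))} (hWs : W ⊆ Set.Iio (0 : ℝ) ×ˢ Set.univ)
    (hnd : ∀ z ∈ W, fderiv ℝ (v z.1) z.2 (EuclideanSpace.single 0 1) 2 ≠ 0 ∨ fderiv ℝ (v z.1) z.2 (EuclideanSpace.single 1 1) 2 ≠ 0)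
    (hpin : ∀ m : ℝ → ℝ, ∀ W' : Set (ℝ × EuclideanSpace ℝ (Fin 3)), W' ⊆ W → IsOpen W' → W'.Nonempty →
      ∃ z ∈ W', ∃ b : Fin 3, b ≠ 2 ∧
        fderiv ℝ (v z.1) z.2 (EuclideanSpace.single 2 1) b ≠
          m z.1 * fderiv ℝ (v z.1) z.2 (EuclideanSpace.single b 1) 2)
    {W₁ : Set (ℝ × EuclideanSpace ℝ (Fin 3))} (hW₁ : IsOpen W₁) (hW₁s : W₁ ⊆ Set.Iio (0 : ℝ) ×ˢ Set.univ)
    (hW₁ne : W₁.Nonempty) {g : ℝ → ℝ → ℝ}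
    (haut : ∀ z ∈ W₁, ∀ b : Fin 3, b ≠ 2 →
      fderiv ℝ (v z.1) z.2 (EuclideanSpace.single 2 1) b =
        g z.1 (v z.1 z.2 2) * fderiv ℝ (v z.1) z.2 (EuclideanSpace.single b 1) 2) :
    ∀ m : ℝ → ℝ → ℝ, ∀ W₂ : Set (ℝ × EuclideanSpace ℝ (Fin 3)), W₂ ⊆ W → IsOpen W₂ → W₂.Nonempty →
      ∃ z ∈ W₂, ∃ b : Fin 3, b ≠ 2 ∧
        fderiv ℝ (v z.1) z.2 (EuclideanSpace.single 2 1) b ≠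
          m z.1 (z.2 2) * fderiv ℝ (v z.1) z.2 (EuclideanSpace.single b 1) 2 := by
  intro m W₂ hW₂W hW₂o hW₂ne
  by_contra hall
  push Not at hall
  obtain ⟨z, hz⟩ := hW₂ne
  have hz1 : z.1 < 0 := (Set.mem_prod.1 (hWs (hW₂W hz))).1
  -- ## (SF) structure near `z` (bridge B1–B3; only the constraint is used)
  obtain ⟨G, hGc, O, hOo, hzO, hOs, hslope, -⟩ :=
    clebschSource_horizConst_of_class_autonomy hrate hcont hmild hdiv hpol hW₁ hW₁s hW₁ne haut hz1 (hnd z (hW₂W hz))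
  have hzO' : z ∈ O := by simpa using hzO
  -- slices of `v₂` are differentiable on the slab
  have hv2 : ∀ z' ∈ O ∩ W₂, DifferentiableAt ℝ (fun y => v z'.1 y 2) z'.2 := by
    intro z' hz'
    have hz'1 : z'.1 < 0 := (Set.mem_prod.1 (hOs hz'.1)).1
    have hd : DifferentiableAt ℝ (v z'.1) z'.2 :=
      (analyticOnNhd_slice hcont (bdd_of_hasTypeITimeDecay hrate) hmild hz'1 z'.2 (Set.mem_univ _)).differentiableAt
    exact ((EuclideanSpace.proj (𝕜 := ℝ) (2 : Fin 3) : EuclideanSpace ℝ (Fin 3) →L[ℝ] ℝ).differentiableAt).comp z'.2 hd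
  have hslope' : ∀ z' ∈ O ∩ W₂, ∀ b : Fin 3, b ≠ 2 →
      fderiv ℝ (v z'.1) z'.2 (EuclideanSpace.single 2 1) b =
        deriv (G z'.1) (v z'.1 z'.2 2) * fderiv ℝ (v z'.1) z'.2 (EuclideanSpace.single b 1) 2 :=
    fun z' hz' b hb => hslope z' hz'.1 b hb
  -- ## a genuinely nonlinear point `z'` of `O ∩ W₂`
  obtain ⟨z', hz', hGN⟩ := exists_gn_point_of_not_tv (hGc.of_le (by norm_cast)) hv2 hpin
    (Set.inter_subset_right.trans hW₂W) hslope' (hOo.inter hW₂o) ⟨hzO', hz⟩ subset_rfl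
  have hz'1 : z'.1 < 0 := (Set.mem_prod.1 (hOs hz'.1)).1
  -- ## a horizontal direction `b` with `∂_b v₂(z') ≠ 0`, and the horizontal line through `z'`
  obtain ⟨b, hb, hDb⟩ : ∃ b : Fin 3, b ≠ 2 ∧ fderiv ℝ (v z'.1) z'.2 (EuclideanSpace.single b 1) 2 ≠ 0 := by
    rcases hnd z' (hW₂W hz'.2) with h | h
    · exact ⟨0, by decide, h⟩
    · exact ⟨1, by decide, h⟩
  set e : EuclideanSpace ℝ (Fin 3) := EuclideanSpace.single b 1 with he
  have he2 : e 2 = 0 := by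
    rw [he]
    fin_cases b <;> simp_all
  -- along the line, for small `s`: in `O ∩ W₂`, and `∂_b v₂ ≠ 0`
  have hline_c : Continuous fun s : ℝ => ((z'.1, z'.2 + s • e) : ℝ × EuclideanSpace ℝ (Fin 3)) :=
    continuous_const.prodMk (continuous_const.add (continuous_id.smul continuous_const))
  have hnear : ∀ᶠ s in 𝓝 (0 : ℝ), ((z'.1, z'.2 + s • e) : ℝ × EuclideanSpace ℝ (Fin 3)) ∈ O ∩ W₂ := by
    have h0 : ((z'.1, z'.2 + (0 : ℝ) • e) : ℝ × EuclideanSpace ℝ (Fin 3)) ∈ O ∩ W₂ := by simpa using hz'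
    exact hline_c.continuousAt.preimage_mem_nhds ((hOo.inter hW₂o).mem_nhds h0)
  have hDcont : Continuous fun y => fderiv ℝ (v z'.1) y (EuclideanSpace.single b 1) 2 :=
    (contDiff_fderiv_coord hrate hcont hmild hdiv hz'1 (EuclideanSpace.single b 1) 2).continuous
  have hDne : ∀ᶠ s in 𝓝 (0 : ℝ), fderiv ℝ (v z'.1) (z'.2 + s • e) (EuclideanSpace.single b 1) 2 ≠ 0 := by
    have hc : ContinuousAt (fun s : ℝ => fderiv ℝ (v z'.1) (z'.2 + s • e) (EuclideanSpace.single b 1) 2) 0 :=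
      (hDcont.comp (continuous_const.add (continuous_id.smul continuous_const))).continuousAt
    exact hc.eventually_ne (by simpa using hDb)
  -- ## on the line the slope function value is the constant `m(t', x₂(z'))`
  have hconst : (fun s : ℝ => deriv (G z'.1) (v z'.1 (z'.2 + s • e) 2)) =ᶠ[𝓝 0] fun _ => m z'.1 (z'.2 2) := by
    filter_upwards [hnear, hDne] with s hs hD
    have h1 := hslope' _ hs b hb
    have h2 := hall _ hs.2 b hb
    have h3 : (z'.2 + s • e) 2 = z'.2 2 := by simp [he2]
    simp only at h1 h2
    rw [h3] at h2
    exact mul_right_cancel₀ hD (h1.symm.trans h2)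
  -- ## differentiate at `s = 0`: `∂_s²G(t', v₂(z'))·∂_b v₂(z') = 0`
  have hG3 : ContDiff ℝ 3 (uncurry G) := hGc.of_le (by norm_cast)
  have hG'2 : ContDiff ℝ 2 (deriv (G z'.1)) :=
    (contDiff_succ_iff_deriv.1 ((hG3.comp (contDiff_const.prodMk contDiff_id)) :
      ContDiff ℝ ((2 : ℕ∞) + 1 : ℕ∞) (G z'.1))).2.2
  have hθd : DifferentiableAt ℝ (fun y => v z'.1 y 2) z'.2 := hv2 z' hz'
  have hinner : HasDerivAt (fun s : ℝ => v z'.1 (z'.2 + s • e) 2) (fderiv ℝ (fun y => v z'.1 y 2) z'.2 e) 0 := by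
    have h1 : HasDerivAt (fun s : ℝ => z'.2 + s • e) e 0 := by
      simpa using ((hasDerivAt_id (0 : ℝ)).smul_const e).const_add z'.2
    exact hθd.hasFDerivAt.comp_hasDerivAt_of_eq (0 : ℝ) h1 (by simp)
  have houter : HasDerivAt (fun s : ℝ => deriv (G z'.1) (v z'.1 (z'.2 + s • e) 2))
      (deriv (deriv (G z'.1)) (v z'.1 (z'.2 + (0 : ℝ) • e) 2) * fderiv ℝ (fun y => v z'.1 y 2) z'.2 e) 0 :=
    ((hG'2.differentiable (by norm_num)) _).hasDerivAt.comp 0 hinner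
  have hzero : deriv (deriv (G z'.1)) (v z'.1 (z'.2 + (0 : ℝ) • e) 2) * fderiv ℝ (fun y => v z'.1 y 2) z'.2 e = 0 := by
    rw [← houter.deriv, hconst.deriv_eq, deriv_const]
  have hDb' : fderiv ℝ (fun y => v z'.1 y 2) z'.2 e ≠ 0 := by
    rw [he, Literature.Analysis.FluidPDE.fderiv_apply_coord
      ((analyticOnNhd_slice hcont (bdd_of_hasTypeITimeDecay hrate) hmild hz'1 z'.2 (Set.mem_univ _)).differentiableAt)]
    exact hDb
  have hGss : deriv (deriv (G z'.1)) (v z'.1 z'.2 2) = 0 := by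
    have h := (mul_eq_zero.1 hzero).resolve_right hDb'
    simpa using h
  exact hGN hGss

end Summit.NavierStokesRegularity.NavierStokesRegularity.Theorems.PoloidalWindowDoorPoloidalWindowRigidityZShockThickOfNotTV

end
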